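import Summits.Ventures.CertifiedArithmetic.LowPrec.ErrorFreeAdd
import Summits.Ventures.CertifiedArithmetic.LowPrec.DirectedEnvelope

/-!
# Scale invariance of the roundings on the normal range (THEOREMS-R1, Theorem E5, core step)

HONEST FRAMING (venture CertifiedArithmetic / cell `pub-lowprec`): certified error envelopes and
provably optimal rounding/accumulation schemes for low-precision formats under stated cost models;
every table by two implementations; no hardware or vendor claims.

For every minifloat format `φ` and every rounding used by the enumeration tables — nearest-even
(`roundNE`), toward zero (`roundTowardZero`), toward −∞ (`roundDown`), toward +∞ (`roundUp`) —
DOUBLING AN INPUT OF THE NORMAL RANGE DOUBLES THE ROUNDED VALUE, provided the doubled input is still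
in range: for `2^m · quantum ≤ |x|` and `|2x| ≤ maxRat`,
`fl(2x) = 2 · fl(x)` (`toRat_roundNE_two_mul`, `toRat_roundTowardZero_two_mul`,
`toRat_roundDown_two_mul`, `toRat_roundUp_two_mul`), hence `fl(2^k x) = 2^k fl(x)`
(`…_two_pow_mul`), the absolute error scales by `2^k` and the RELATIVE error is unchanged
(`relErr_roundNE_two_pow_mul` and the generic `relErr_map_two_pow_mul`).

This is the step of Theorem E5 of `THEOREMS-R1.md` (sec. 3) which says that in a normal band of the
result format the rounding error of `x = n · 2^e · quantum`, relative to `|x|` or in ulps, depends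
on the integer pattern `n` alone and not on the binade `e`; it is what reduces the normal-band
envelope constants of a whole table (max relative error, max ulps; `ENVELOPES.md`) to a maximum
over finitely many significand patterns (`code/enum/envconst.py`, pre-registered predictions
`certs/enum/PREDICTIONS-ENVCONST.json`). No exception is needed in the top binade: `maxScaled` is a
grid point, a multiple of every local spacing, so an in-range input never rounds (to nearest or
down) above it (`Format.rneMult_le_maxScaled_of_le`).

Grid level (magnitudes in quanta, `Format.rneGrid` / `rdGrid` / `ruGrid`): doubling a normal
magnitude moves it exactly one binade up (`Format.shift_floor_two_mul`), so the local spacing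
doubles and the scaled quotient `r / 2^s` is unchanged; the three grid roundings therefore commute
with doubling (`Format.rneGrid_two_mul`, `rdGrid_two_mul`, `ruGrid_two_mul`).

Placement: venture development under `Summits/Ventures/CertifiedArithmetic/`; declarations are
dot-notation extensions of the Literature structures `Format` / `MiniFloat` and carry their
absolute `Literature.ComputerArithmetic.FloatingPoint.…` names (CONVENTIONS §2). New work of the
venture (elementary; [folklore] tags mark statements any numerical analyst would recognise,
cf. [cite: Higham2002ASNA, §2.1] on the scaling symmetry of floating-point number systems).
-/

namespace Literature.ComputerArithmetic.FloatingPoint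

/-! ### From doubling to scaling by powers of two (generic) -/

/-- A map that commutes with doubling on the band `L ≤ |x|`, `|2x| ≤ M` (`L ≥ 0`) commutes with
multiplication by `2^k` there. [folklore] -/
theorem map_two_pow_mul_of_two_mul {f : ℚ → ℚ} {L M : ℚ} (hL : 0 ≤ L)
    (h : ∀ x : ℚ, L ≤ |x| → |2 * x| ≤ M → f (2 * x) = 2 * f x)
    (k : ℕ) {x : ℚ} (hlo : L ≤ |x|) (hhi : |2 ^ k * x| ≤ M) :
    f (2 ^ k * x) = 2 ^ k * f x := by
  induction k with
  | zero => simp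
  | succ k ih =>
    have hk0 : (0 : ℚ) < 2 ^ k := by positivity
    have hk1 : (1 : ℚ) ≤ 2 ^ k := one_le_pow₀ (by norm_num)
    have hxk : 0 ≤ 2 ^ k * |x| := mul_nonneg hk0.le (abs_nonneg x)
    have hlo' : L ≤ |2 ^ k * x| := by
      rw [abs_mul, abs_of_pos hk0]
      calc L = 1 * L := (one_mul L).symm
        _ ≤ 2 ^ k * L := mul_le_mul_of_nonneg_right hk1 hL
        _ ≤ 2 ^ k * |x| := mul_le_mul_of_nonneg_left hlo hk0.le
    have e : (2 : ℚ) ^ (k + 1) * x = 2 * (2 ^ k * x) := by rw [pow_succ]; ring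
    have hhi' : |2 ^ k * x| ≤ M := by
      refine le_trans ?_ hhi
      rw [e, abs_mul 2, abs_two, abs_mul, abs_of_pos hk0]
      linarith
    rw [e, h _ hlo' (by rw [← e]; exact hhi), ih hhi']
    ring

/-- If `f (2^k x) = 2^k f x` then the absolute error at `2^k x` is `2^k` times the error at `x`.
[folklore] -/
theorem abs_sub_map_two_pow_mul {f : ℚ → ℚ} {k : ℕ} {x : ℚ} (h : f (2 ^ k * x) = 2 ^ k * f x) :
    |2 ^ k * x - f (2 ^ k * x)| = 2 ^ k * |x - f x| := by
  rw [h, ← mul_sub, abs_mul, abs_of_pos (by positivity)]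

/-- If `f (2^k x) = 2^k f x` then the relative error at `2^k x` equals the relative error at `x`.
[folklore] -/
theorem relErr_map_two_pow_mul {f : ℚ → ℚ} {k : ℕ} {x : ℚ} (h : f (2 ^ k * x) = 2 ^ k * f x) :
    |2 ^ k * x - f (2 ^ k * x)| / |2 ^ k * x| = |x - f x| / |x| := by
  rw [abs_sub_map_two_pow_mul h, abs_mul, abs_of_pos (by positivity : (0 : ℚ) < 2 ^ k)]
  exact mul_div_mul_left _ _ (by positivity)

namespace Format

variable {φ : Format}

/-! ### Grid level: doubling moves one binade up -/

/-- Doubling and the integer part: `2⌊r⌋ ≤ ⌊2r⌋ ≤ 2⌊r⌋ + 1` (`r ≥ 0`, as naturals). [folklore] -/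
theorem floor_toNat_two_mul {r : ℚ} (hr : 0 ≤ r) :
    2 * ⌊r⌋.toNat ≤ ⌊2 * r⌋.toNat ∧ ⌊2 * r⌋.toNat ≤ 2 * ⌊r⌋.toNat + 1 := by
  have h0 : 0 ≤ ⌊r⌋ := Int.floor_nonneg.mpr hr
  have h1 : ((⌊r⌋ : ℤ) : ℚ) ≤ r := Int.floor_le r
  have h2 : r < (⌊r⌋ : ℚ) + 1 := Int.lt_floor_add_one r
  have hlo : 2 * ⌊r⌋ ≤ ⌊2 * r⌋ := Int.le_floor.mpr (by push_cast; linarith)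
  have hhi : ⌊2 * r⌋ < 2 * ⌊r⌋ + 2 := Int.floor_lt.mpr (by push_cast; linarith)
  omega

/-- DOUBLING MOVES ONE BINADE UP: for a normal magnitude (`2^m ≤ ⌊r⌋`) with a binade to spare,
`shift ⌊2r⌋ = shift ⌊r⌋ + 1` — the local spacing doubles. [folklore] -/
theorem shift_floor_two_mul {r : ℚ} (hr : 0 ≤ r) (hn : 2 ^ φ.manBits ≤ ⌊r⌋.toNat)
    (hs : φ.shift ⌊r⌋.toNat + 1 ≤ φ.emaxCode - 1) :
    φ.shift ⌊2 * r⌋.toNat = φ.shift ⌊r⌋.toNat + 1 := by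
  have h1 : 2 ^ (φ.manBits + φ.shift ⌊r⌋.toNat) ≤ ⌊r⌋.toNat := pow_shift_le hn
  have h2 : ⌊r⌋.toNat < 2 ^ (φ.manBits + 1 + φ.shift ⌊r⌋.toNat) := lt_pow_shift (by omega)
  obtain ⟨hlo, hhi⟩ := floor_toNat_two_mul hr
  refine MiniFloat.shift_eq_of_bounds ?_ ?_ hs
  · have e : 2 ^ (φ.manBits + (φ.shift ⌊r⌋.toNat + 1))
        = 2 ^ (φ.manBits + φ.shift ⌊r⌋.toNat) * 2 := by
      rw [show φ.manBits + (φ.shift ⌊r⌋.toNat + 1) = (φ.manBits + φ.shift ⌊r⌋.toNat) + 1 by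
        omega, pow_succ]
    omega
  · have e : 2 ^ (φ.manBits + 1 + (φ.shift ⌊r⌋.toNat + 1))
        = 2 ^ (φ.manBits + 1 + φ.shift ⌊r⌋.toNat) * 2 := by
      rw [show φ.manBits + 1 + (φ.shift ⌊r⌋.toNat + 1)
          = (φ.manBits + 1 + φ.shift ⌊r⌋.toNat) + 1 by omega, pow_succ]
    omega

/-- Room above: a normal magnitude whose double is still `≤ maxScaled` does not lie in the top
binade, `shift ⌊r⌋ + 1 ≤ emaxCode - 1`. [folklore] -/
theorem shift_floor_succ_le {r : ℚ} (hr : 0 ≤ r) (hn : 2 ^ φ.manBits ≤ ⌊r⌋.toNat)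
    (hle : 2 * r ≤ φ.maxScaled) : φ.shift ⌊r⌋.toNat + 1 ≤ φ.emaxCode - 1 := by
  have h1 : 2 ^ (φ.manBits + φ.shift ⌊r⌋.toNat) ≤ ⌊r⌋.toNat := pow_shift_le hn
  have h3 : 2 * ⌊r⌋.toNat ≤ φ.maxScaled := by
    have h := floor_toNat_le hr
    have : ((2 * ⌊r⌋.toNat : ℕ) : ℚ) ≤ φ.maxScaled := by push_cast; linarith
    exact_mod_cast this
  have hm : 2 ^ φ.manBits ≤ 2 ^ (φ.manBits + φ.shift ⌊r⌋.toNat) :=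
    Nat.pow_le_pow_right (by norm_num) (by omega)
  have hE : 1 ≤ φ.emaxCode := by
    by_contra h0
    have hM := maxScaled_eq_topMan (φ := φ) (by omega)
    have ht := φ.topMan_lt
    omega
  have h2 := maxScaled_lt_pow (φ := φ) hE
  by_contra hlt
  have h4 : 2 ^ (φ.manBits + φ.emaxCode) ≤ 2 ^ ((φ.manBits + φ.shift ⌊r⌋.toNat) + 1) :=
    Nat.pow_le_pow_right (by norm_num) (by omega)
  rw [pow_succ] at h4
  omega

/-- Doubling leaves the scaled quotient unchanged: `2r / 2^(s+1) = r / 2^s`. [folklore] -/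
theorem two_mul_div_pow_succ (r : ℚ) (s : ℕ) : 2 * r / (2 : ℚ) ^ (s + 1) = r / 2 ^ s := by
  rw [mul_comm, pow_succ, mul_div_mul_right _ _ two_ne_zero]

/-! ### Grid level: the three grid roundings commute with doubling -/

/-- The unclamped RNE multiple doubles with its input (normal range, a binade to spare).
[folklore] -/
theorem rneMult_two_mul {r : ℚ} (hr : 0 ≤ r) (hn : 2 ^ φ.manBits ≤ ⌊r⌋.toNat)
    (hs : φ.shift ⌊r⌋.toNat + 1 ≤ φ.emaxCode - 1) :
    φ.rneMult (2 * r) = 2 * φ.rneMult r := by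
  unfold rneMult
  rw [shift_floor_two_mul hr hn hs, two_mul_div_pow_succ, pow_succ]
  ring

/-- NO CLAMPING IN RANGE: for `0 ≤ r ≤ maxScaled` the unclamped RNE multiple is `≤ maxScaled`
(`maxScaled` is a multiple of the local spacing lying above `r`). [folklore] -/
theorem rneMult_le_maxScaled_of_le {r : ℚ} (hr : 0 ≤ r) (hle : r ≤ φ.maxScaled) :
    φ.rneMult r ≤ φ.maxScaled := by
  have hc : (0 : ℚ) < 2 ^ φ.shift ⌊r⌋.toNat := by positivity
  have hdv : 2 ^ φ.shift ⌊r⌋.toNat ∣ φ.maxScaled := by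
    rcases shift_floor_dichotomy (φ := φ) hr with hs | hfloor
    · rw [hs]; exact one_dvd _
    · exact pow_dvd_of_representable (MiniFloat.representable_maxScaled φ)
        (by exact_mod_cast le_trans hfloor hle)
  obtain ⟨M, hM⟩ := hdv
  have hrM : r / 2 ^ φ.shift ⌊r⌋.toNat ≤ ((M : ℕ) : ℤ) := by
    rw [div_le_iff₀ hc]; push_cast
    calc r ≤ φ.maxScaled := hle
      _ = (M : ℚ) * 2 ^ φ.shift ⌊r⌋.toNat := by rw [hM]; push_cast; ring
  have hq := rneInt_le_of_le hrM
  unfold rneMult; rw [hM, mul_comm (2 ^ _) M]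
  apply Nat.mul_le_mul_right; omega

/-- ROUND-TO-NEAREST-EVEN COMMUTES WITH DOUBLING on the grid: for a normal magnitude `r`
(`2^m ≤ ⌊r⌋`) with `2r ≤ maxScaled`, `rneGrid (2r) = 2 · rneGrid r`. [folklore] -/
theorem rneGrid_two_mul {r : ℚ} (hr : 0 ≤ r) (hn : 2 ^ φ.manBits ≤ ⌊r⌋.toNat)
    (hle : 2 * r ≤ φ.maxScaled) : φ.rneGrid (2 * r) = 2 * φ.rneGrid r := by
  have hs := shift_floor_succ_le hr hn hle
  have hr2 : 0 ≤ 2 * r := by linarith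
  have hm2 := rneMult_le_maxScaled_of_le hr2 hle
  have hm1 := rneMult_le_maxScaled_of_le hr (by linarith)
  rw [rneGrid_eq_min, rneGrid_eq_min, min_eq_left hm2, min_eq_left hm1, rneMult_two_mul hr hn hs]

/-- ROUND-DOWN COMMUTES WITH DOUBLING on the grid: `rdGrid (2r) = 2 · rdGrid r` for a normal
magnitude with `2r ≤ maxScaled`. [folklore] -/
theorem rdGrid_two_mul {r : ℚ} (hr : 0 ≤ r) (hn : 2 ^ φ.manBits ≤ ⌊r⌋.toNat)
    (hle : 2 * r ≤ φ.maxScaled) : φ.rdGrid (2 * r) = 2 * φ.rdGrid r := by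
  have hs := shift_floor_succ_le hr hn hle
  rw [rdGrid_eq_floor_mul (by linarith) hle, rdGrid_eq_floor_mul hr (by linarith),
    shift_floor_two_mul hr hn hs, two_mul_div_pow_succ, pow_succ]
  ring

/-- ROUND-UP COMMUTES WITH DOUBLING on the grid: `ruGrid (2r) = 2 · ruGrid r` for a normal
magnitude with `2r ≤ maxScaled`. [folklore] -/
theorem ruGrid_two_mul {r : ℚ} (hr : 0 ≤ r) (hn : 2 ^ φ.manBits ≤ ⌊r⌋.toNat)
    (hle : 2 * r ≤ φ.maxScaled) : φ.ruGrid (2 * r) = 2 * φ.ruGrid r := by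
  have hs := shift_floor_succ_le hr hn hle
  unfold ruGrid
  rw [if_pos hle, if_pos (show r ≤ φ.maxScaled by linarith), shift_floor_two_mul hr hn hs,
    two_mul_div_pow_succ, pow_succ]
  ring

end Format

/-! ### Signed roundings: `fl (2x) = 2 fl x` on the normal range -/

namespace MiniFloat

variable {φ : Format}

/-- Scaled input of a doubled argument. [folklore] -/
theorem scaledInput_two_mul (x : ℚ) : |2 * x| / φ.quantum = 2 * (|x| / φ.quantum) := by
  rw [abs_mul, abs_two]; ring

/-- A normal input has a normal scaled magnitude: `2^m · quantum ≤ |x|` gives `2^m ≤ ⌊|x|/quantum⌋`.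
[folklore] -/
theorem pow_le_floor_scaledInput {x : ℚ} (hlo : 2 ^ φ.manBits * φ.quantum ≤ |x|) :
    2 ^ φ.manBits ≤ ⌊|x| / φ.quantum⌋.toNat := by
  have hq := φ.quantum_pos
  have h1 : (((2 ^ φ.manBits : ℕ) : ℤ) : ℚ) ≤ |x| / φ.quantum := by
    rw [le_div_iff₀ hq]; push_cast; exact hlo
  have h2 := Int.le_floor.mpr h1
  omega

/-- The range condition in quanta: `|2x| ≤ maxRat` gives `2 · (|x|/quantum) ≤ maxScaled`.
[folklore] -/
theorem two_mul_scaledInput_le {x : ℚ} (hhi : |2 * x| ≤ φ.maxRat) :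
    2 * (|x| / φ.quantum) ≤ φ.maxScaled := by
  rw [← scaledInput_two_mul, div_le_iff₀ φ.quantum_pos]
  exact hhi

/-- The sign test is unchanged by doubling. [folklore] -/
theorem two_mul_neg_iff (x : ℚ) : 2 * x < 0 ↔ x < 0 := by
  constructor <;> intro h <;> linarith

/-- ROUND-TO-NEAREST-EVEN COMMUTES WITH DOUBLING: for `2^m · quantum ≤ |x|` (normal) and
`|2x| ≤ maxRat` (in range), `fl(2x) = 2 fl(x)`. [folklore] -/
theorem toRat_roundNE_two_mul {x : ℚ} (hlo : 2 ^ φ.manBits * φ.quantum ≤ |x|)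
    (hhi : |2 * x| ≤ φ.maxRat) : (roundNE φ (2 * x)).toRat = 2 * (roundNE φ x).toRat := by
  have key := Format.rneGrid_two_mul (scaledInput_nonneg x) (pow_le_floor_scaledInput hlo)
    (two_mul_scaledInput_le hhi)
  rw [toRat_roundNE, toRat_roundNE, scaledInput_two_mul, key]
  by_cases hx : x < 0
  · rw [if_pos ((two_mul_neg_iff x).mpr hx), if_pos hx]; push_cast; ring
  · rw [if_neg (mt (two_mul_neg_iff x).mp hx), if_neg hx]; push_cast; ring

/-- ROUND-TOWARD-ZERO COMMUTES WITH DOUBLING (normal, in range). [folklore] -/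
theorem toRat_roundTowardZero_two_mul {x : ℚ} (hlo : 2 ^ φ.manBits * φ.quantum ≤ |x|)
    (hhi : |2 * x| ≤ φ.maxRat) :
    (roundTowardZero φ (2 * x)).toRat = 2 * (roundTowardZero φ x).toRat := by
  have key := Format.rdGrid_two_mul (scaledInput_nonneg x) (pow_le_floor_scaledInput hlo)
    (two_mul_scaledInput_le hhi)
  rw [toRat_roundTowardZero, toRat_roundTowardZero, scaledInput_two_mul, key]
  by_cases hx : x < 0
  · rw [if_pos ((two_mul_neg_iff x).mpr hx), if_pos hx]; push_cast; ring
  · rw [if_neg (mt (two_mul_neg_iff x).mp hx), if_neg hx]; push_cast; ring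

/-- ROUND-DOWN (toward −∞) COMMUTES WITH DOUBLING (normal, in range). [folklore] -/
theorem toRat_roundDown_two_mul {x : ℚ} (hlo : 2 ^ φ.manBits * φ.quantum ≤ |x|)
    (hhi : |2 * x| ≤ φ.maxRat) :
    (roundDown φ (2 * x)).toRat = 2 * (roundDown φ x).toRat := by
  have hn := pow_le_floor_scaledInput hlo
  have hle := two_mul_scaledInput_le hhi
  rw [toRat_roundDown, toRat_roundDown, scaledInput_two_mul]
  by_cases hx : x < 0
  · rw [if_pos ((two_mul_neg_iff x).mpr hx), if_pos hx,
      Format.ruGrid_two_mul (scaledInput_nonneg x) hn hle]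
    push_cast; ring
  · rw [if_neg (mt (two_mul_neg_iff x).mp hx), if_neg hx,
      Format.rdGrid_two_mul (scaledInput_nonneg x) hn hle]
    push_cast; ring

/-- ROUND-UP (toward +∞) COMMUTES WITH DOUBLING (normal, in range). [folklore] -/
theorem toRat_roundUp_two_mul {x : ℚ} (hlo : 2 ^ φ.manBits * φ.quantum ≤ |x|)
    (hhi : |2 * x| ≤ φ.maxRat) :
    (roundUp φ (2 * x)).toRat = 2 * (roundUp φ x).toRat := by
  have hn := pow_le_floor_scaledInput hlo
  have hle := two_mul_scaledInput_le hhi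
  rw [toRat_roundUp, toRat_roundUp, scaledInput_two_mul]
  by_cases hx : x < 0
  · rw [if_pos ((two_mul_neg_iff x).mpr hx), if_pos hx,
      Format.rdGrid_two_mul (scaledInput_nonneg x) hn hle]
    push_cast; ring
  · rw [if_neg (mt (two_mul_neg_iff x).mp hx), if_neg hx,
      Format.ruGrid_two_mul (scaledInput_nonneg x) hn hle]
    push_cast; ring

/-! ### Scaling by `2^k`: error scales, relative error is invariant -/

/-- `fl(2^k x) = 2^k fl(x)` for round-to-nearest-even, `2^m · quantum ≤ |x|`, `|2^k x| ≤ maxRat`.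
[folklore] -/
theorem toRat_roundNE_two_pow_mul (k : ℕ) {x : ℚ} (hlo : 2 ^ φ.manBits * φ.quantum ≤ |x|)
    (hhi : |2 ^ k * x| ≤ φ.maxRat) :
    (roundNE φ (2 ^ k * x)).toRat = 2 ^ k * (roundNE φ x).toRat :=
  map_two_pow_mul_of_two_mul (f := fun y => (roundNE φ y).toRat)
    (le_of_lt (mul_pos (by positivity) φ.quantum_pos))
    (fun _ h1 h2 => toRat_roundNE_two_mul h1 h2) k hlo hhi

/-- `fl(2^k x) = 2^k fl(x)` for round-toward-zero (normal, in range). [folklore] -/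
theorem toRat_roundTowardZero_two_pow_mul (k : ℕ) {x : ℚ}
    (hlo : 2 ^ φ.manBits * φ.quantum ≤ |x|) (hhi : |2 ^ k * x| ≤ φ.maxRat) :
    (roundTowardZero φ (2 ^ k * x)).toRat = 2 ^ k * (roundTowardZero φ x).toRat :=
  map_two_pow_mul_of_two_mul (f := fun y => (roundTowardZero φ y).toRat)
    (le_of_lt (mul_pos (by positivity) φ.quantum_pos))
    (fun _ h1 h2 => toRat_roundTowardZero_two_mul h1 h2) k hlo hhi

/-- `fl(2^k x) = 2^k fl(x)` for round-down (normal, in range). [folklore] -/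
theorem toRat_roundDown_two_pow_mul (k : ℕ) {x : ℚ}
    (hlo : 2 ^ φ.manBits * φ.quantum ≤ |x|) (hhi : |2 ^ k * x| ≤ φ.maxRat) :
    (roundDown φ (2 ^ k * x)).toRat = 2 ^ k * (roundDown φ x).toRat :=
  map_two_pow_mul_of_two_mul (f := fun y => (roundDown φ y).toRat)
    (le_of_lt (mul_pos (by positivity) φ.quantum_pos))
    (fun _ h1 h2 => toRat_roundDown_two_mul h1 h2) k hlo hhi

/-- `fl(2^k x) = 2^k fl(x)` for round-up (normal, in range). [folklore] -/
theorem toRat_roundUp_two_pow_mul (k : ℕ) {x : ℚ}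
    (hlo : 2 ^ φ.manBits * φ.quantum ≤ |x|) (hhi : |2 ^ k * x| ≤ φ.maxRat) :
    (roundUp φ (2 ^ k * x)).toRat = 2 ^ k * (roundUp φ x).toRat :=
  map_two_pow_mul_of_two_mul (f := fun y => (roundUp φ y).toRat)
    (le_of_lt (mul_pos (by positivity) φ.quantum_pos))
    (fun _ h1 h2 => toRat_roundUp_two_mul h1 h2) k hlo hhi

/-- THEOREM E5, CORE (relative error depends on the significand pattern, not the binade): for
round-to-nearest-even, `2^m · quantum ≤ |x|` and `|2^k x| ≤ maxRat`, the relative error at `2^k x`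
equals the relative error at `x`, and the absolute error is `2^k` times as large. [folklore] -/
theorem relErr_roundNE_two_pow_mul (k : ℕ) {x : ℚ} (hlo : 2 ^ φ.manBits * φ.quantum ≤ |x|)
    (hhi : |2 ^ k * x| ≤ φ.maxRat) :
    |2 ^ k * x - (roundNE φ (2 ^ k * x)).toRat| / |2 ^ k * x|
        = |x - (roundNE φ x).toRat| / |x| ∧
      |2 ^ k * x - (roundNE φ (2 ^ k * x)).toRat| = 2 ^ k * |x - (roundNE φ x).toRat| :=
  ⟨relErr_map_two_pow_mul (f := fun y => (roundNE φ y).toRat)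
      (toRat_roundNE_two_pow_mul k hlo hhi),
    abs_sub_map_two_pow_mul (f := fun y => (roundNE φ y).toRat)
      (toRat_roundNE_two_pow_mul k hlo hhi)⟩

/-- The same for the directed roundings: relative error invariant under `x ↦ 2^k x` on the normal
range, for round-toward-zero, round-down and round-up. [folklore] -/
theorem relErr_directed_two_pow_mul (k : ℕ) {x : ℚ} (hlo : 2 ^ φ.manBits * φ.quantum ≤ |x|)
    (hhi : |2 ^ k * x| ≤ φ.maxRat) :
    |2 ^ k * x - (roundTowardZero φ (2 ^ k * x)).toRat| / |2 ^ k * x|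
        = |x - (roundTowardZero φ x).toRat| / |x| ∧
      |2 ^ k * x - (roundDown φ (2 ^ k * x)).toRat| / |2 ^ k * x|
        = |x - (roundDown φ x).toRat| / |x| ∧
      |2 ^ k * x - (roundUp φ (2 ^ k * x)).toRat| / |2 ^ k * x|
        = |x - (roundUp φ x).toRat| / |x| :=
  ⟨relErr_map_two_pow_mul (f := fun y => (roundTowardZero φ y).toRat)
      (toRat_roundTowardZero_two_pow_mul k hlo hhi),
    relErr_map_two_pow_mul (f := fun y => (roundDown φ y).toRat)
      (toRat_roundDown_two_pow_mul k hlo hhi),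
    relErr_map_two_pow_mul (f := fun y => (roundUp φ y).toRat)
      (toRat_roundUp_two_pow_mul k hlo hhi)⟩

end MiniFloat

end Literature.ComputerArithmetic.FloatingPoint
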